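import Literature.NumberTheory.Automorphic.AutomorphicRepsGLAssociatedL2Holds
import Literature.NumberTheory.Automorphic.AutomorphicRepsGLCleanModelArch
import Literature.NumberTheory.Automorphic.AutomorphicRepDataSplitCenter
import Literature.NumberTheory.Automorphic.AutomorphicTwistNorm
import Literature.NumberTheory.Automorphic.JacquetLanglandsLeavesProofs
import Literature.NumberTheory.Automorphic.GLnCentralCharacter
import Literature.NumberTheory.Automorphic.ArchParameterUnique
import Literature.NumberTheory.Automorphic.IdeleClassGroupProofs
import Literature.NumberTheory.Automorphic.AdelicGroupDataAutomorphicMeasureProofs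
import Literature.NumberTheory.GaloisRepresentations.HeckeCharacterWeakApproximation
import HarnessLib

/-!
# Strong multiplicity one for cuspidal Borel–Jacquet data, with the archimedean components,
# from the `L²` leaves (proofs)

Topic `NumberTheory/Automorphic`; a proof file (theorems only: no definition, no named fact, no
instance). The tree states strong multiplicity one for `GL_n` in the `L²` model and on Satake
parameters only (`strong_multiplicity_one_gl`, `strong_multiplicity_one_gl_sphericalLevel`:
two cuspidal `Π, Π' ⊂ L²_cusp(GL_n(K) A_G \ GL_n(𝔸_K))` with the same Satake parameters off a finite
set coincide as subspaces). Several accepted reductions on Borel–Jacquet data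
(`AutomorphicRepData`, Borel–Jacquet 1979, §4.6) need the printed form of Jacquet–Shalika's
theorem WITH the archimedean components — "`π_v ≅ π'_v` for almost all `v` implies `π ≅ π'`, in
particular `π_∞ ≅ π'_∞`" (Jacquet–Shalika 1981, Thm. 4.4; Piatetski-Shapiro 1979) — read on the
carriers of the tree as: nearly equivalent cuspidal data have the same archimedean parameter,
hence infinity types with the same multisets of `z`-exponents (hypothesis `hsmo` / `harch` of
`Patrikis2019_cmDescent_of_clozel_of_smo`, `…_of_archParameter` in
`PatrikisCMDescentGaloisImageProofs`, and of `PatrikisCMDescentProofs`; the cuspidal case of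
`hRig` in `HenniartAutomorphicInductionAssembly`). This file PROVES that form from the two
`L²`-model named facts, through the Borel–Jacquet dictionary, all of whose other pieces are
theorems of the tree:

* `CuspidalAutomorphicRepData.exists_twist_eq_formsOfL2_of_clean` — **unitary normalisation,
  `W`-level form** ("we may assume `π` unitary", Borel–Jacquet 1979, 5.7): a clean cuspidal datum
  `π₀ = W₀ / ⊥` (`n ≥ 1`) has `W₀ ⊗ |det|^{s} = V_Π` for some `s ∈ ℂ` and some cuspidal
  `Π ⊂ L²_cusp`, whose Satake parameters at level `K(𝔫)` are `q_v^{-s} t_{π₀,v}`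
  (`exists_apply_posRealScalar_mul_eq_cpow`, `AutomorphicTwistNorm`,
  `AutomorphicRepsGL.exists_isAssociatedL2_holds`, the named fact `hasSatakeParamAt_iff_L2`);
* `CuspidalAutomorphicRepData.W_eq_of_isNearlyEquivalent_of_clean` — **two nearly equivalent
  clean cuspidal data have the same space of forms** (`W₀ = W₀'`): their normalising exponents
  agree — the central characters `ω_Π`, `ω_{Π'}` (`CuspidalAutomorphicRepGL.exists_centralCharacter`:
  Hecke characters trivial on `A_G` with `ω_Π(ϖ_v) = e_n(t_{Π,v})`) satisfy
  `(ω_{Π'} ω_Π⁻¹)(ϖ_v) = q_v^{n(s-s')}` at almost all `v`, so `ω_{Π'} ω_Π⁻¹ = ‖·‖^{-n(s-s')}`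
  (a Hecke character is determined by almost all `χ(ϖ_v)`,
  `HeckeCharacter.ext_of_eventually_valueAtUniformizer_eq`), and evaluating on `A_G` gives
  `r^{-[K:ℚ]n(s-s')} = 1` for all `r > 0`, i.e. `s = s'`; then `Π`, `Π'` have the same Satake
  parameters at the local spherical levels off a finite set (`JacquetLanglandsLeavesProofs`:
  uniqueness, independence of level and uniformizer), so `Π = Π'` by
  `strong_multiplicity_one_gl_sphericalLevel`, and untwisting `V_Π` by `|det|^{-s}` gives
  `W₀ = W₀'`;
* `CuspidalAutomorphicRepData.hasArchParameter_eq_of_isNearlyEquivalent` — **nearly equivalent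
  cuspidal data have the same archimedean parameter** (`n ≥ 1`): pass to clean models keeping
  Satake and archimedean parameters (`AutomorphicRepsGLCleanModelArch`, with the proved
  semisimplicity `stable_cuspidal_eq_sSup_irreducible_holds`), which are then EQUAL data, and use
  the uniqueness of the archimedean parameter of one datum (`hasArchParameter_unique`);
* `CuspidalAutomorphicRepData.map_a_eq_of_isNearlyEquivalent` — the same on infinity types
  (`HasInfinityType`: equal multisets of `z`-exponents at every complex embedding), all `n`, with
  the automorphic measure supplied by `AdelicGroupData.exists_isAutomorphicMeasure_gl_holds` — the
  literal hypothesis `hsmo` of `Patrikis2019_cmDescent_of_clozel_of_smo`.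

So the archimedean form of strong multiplicity one for Borel–Jacquet cuspidal data is no longer
an independent input: it follows from the named facts `hasSatakeParamAt_iff_L2` (Borel–Jacquet
1979, 4.6) and `strong_multiplicity_one_gl_sphericalLevel` (Jacquet–Shalika 1981, Thm. 4.4 with
multiplicity one; proved in the tree for `n ≤ 1`).

## References

* H. Jacquet, J. A. Shalika, *On Euler products and the classification of automorphic forms II*,
  Amer. J. Math. 103 (1981), 777–815, Thm. 4.4. [JacquetShalikaAJM1981II]
* A. Borel, H. Jacquet, *Automorphic forms and automorphic representations*, Proc. Sympos. Pure
  Math. 33 (1979), part 1, §4.6 and 5.7. [BorelJacquetCorvallis1979]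
* J. Arthur, L. Clozel, *Simple algebras, base change, and the advanced theory of the trace
  formula*, Ann. of Math. Stud. 120 (1989), Ch. 3, proof of Thm. 3.1 ("We may assume `π, π'`
  unitary"). [ArthurClozelAMS120]
* J. W. S. Cassels, A. Fröhlich (eds.), *Algebraic Number Theory* (1967), Ch. VII §4, Prop. 4.1.
  [CasselsFrohlichANT1967]
-/

noncomputable section

open scoped MatrixGroups NNReal Classical
open NumberField IsDedekindDomain MeasureTheory Filter

namespace Literature.NumberTheory.Automorphic

open AdelicGroupData
open Literature.NumberTheory.GaloisRepresentations (HeckeCharacter ideleGroup)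

variable {n : ℕ} {K : Type} [Field K] [NumberField K] {hcpt : isCompact_glFiniteIntegralLevel n K}

/-! ### Two elementary lemmas -/

section Elementary

/-- If `exp (x c) = 1` for every real `x` then `c = 0` (differentiate at `x = 0`). [folklore] -/
private theorem eq_zero_of_forall_exp_ofReal_mul_eq_one {c : ℂ}
    (h : ∀ x : ℝ, Complex.exp ((x : ℂ) * c) = 1) : c = 0 := by
  have h1 : HasDerivAt (fun y : ℂ => Complex.exp (y * c))
      (Complex.exp ((((0 : ℝ) : ℂ)) * c) * c) (((0 : ℝ) : ℂ)) :=
    (hasDerivAt_mul_const c).cexp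
  have h2 : HasDerivAt (fun x : ℝ => Complex.exp ((x : ℂ) * c))
      (Complex.exp ((((0 : ℝ) : ℂ)) * c) * c) 0 := h1.comp_ofReal
  have hfun : (fun x : ℝ => Complex.exp ((x : ℂ) * c)) = fun _ => (1 : ℂ) := funext h
  rw [hfun] at h2
  have h3 : Complex.exp ((((0 : ℝ) : ℂ)) * c) * c = 0 := h2.unique (hasDerivAt_const (0 : ℝ) (1 : ℂ))
  exact (mul_eq_zero.1 h3).resolve_left (Complex.exp_ne_zero _)

/-- **`‖ϖ_v‖^s = q_v^{-s}`**: the value at (the chosen uniformizer of) `v` of the norm-power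
character `χ(x) = ‖x‖_𝔸^s` is `((q_v : ℂ)^{s})⁻¹` (`‖ϖ_v‖_v = q_v⁻¹`; same computation as
`HeckeCharacter.valueAtUniformizer_of_cpow` of `CuspidalDescentDetCubicRepData`, repeated to keep
the imports of this file independent of that one). [folklore] -/
private theorem valueAtUniformizer_of_cpow' {χ : HeckeCharacter K} {s : ℂ}
    (hχ : ∀ x : ideleGroup K, ((χ x : ℂˣ) : ℂ) = (GaloisRepresentations.ideleNorm x : ℂ) ^ s)
    (v : HeightOneSpectrum (𝓞 K)) :
    χ.valueAtUniformizer v = (((v.residueCard : ℂ)) ^ s)⁻¹ := by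
  have hi : (1 : ℕ) ≤ 1 := le_rfl
  have h := ideleNorm_det_heckeDiagAt (n := 1) (K := K)
    (GaloisRepresentations.HeckeCharacter.valued_uniformizer v) hi
  rw [det_heckeDiagAt v _ hi, pow_one, pow_one] at h
  rw [GaloisRepresentations.HeckeCharacter.valueAtUniformizer,
    GaloisRepresentations.HeckeCharacter.localComponent_apply, hχ, h, Complex.ofReal_inv,
    Complex.ofReal_natCast, Complex.inv_cpow _ _ (by rw [Complex.natCast_arg]; exact Real.pi_ne_zero.symm)]

/-- Two Borel–Jacquet data on `GL_n(𝔸_K)` with the same spaces `W` and `W'` are equal (the other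
fields of `AutomorphicRepData` are propositions). [folklore] -/
private theorem repData_eq_of_W_eq {π π' : AutomorphicRepData (AutomorphyDatum.gl n K hcpt)}
    (hW : π.W = π'.W) (hW' : π.W' = π'.W') : π = π' := by
  cases π
  cases π'
  dsimp only at hW hW'
  subst hW
  subst hW'
  rfl

end Elementary

/-! ### Unitary normalisation of a clean cuspidal datum, `W`-level form -/

section Normalisation

/-- **"We may assume `π` unitary", `W`-level form** (Borel–Jacquet 1979, 5.7; Arthur–Clozel 1989,
Ch. 3, proof of Thm. 3.1). Let `π₀ = W₀ / ⊥` be a clean cuspidal Borel–Jacquet datum on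
`GL_n(𝔸_K)`, `n ≥ 1`. Then there are `s ∈ ℂ`, the Hecke character `χ = ‖·‖_𝔸^s` and a cuspidal
`Π ⊂ L²_cusp(GL_n(K) A_G \ GL_n(𝔸_K), μ)` with **`W₀ ⊗ (χ ∘ det) = V_Π`** (the space of automorphic
forms of `Π`, `formsOfL2`) and such that every Satake parameter `α` of `π₀` at `v` gives the
Satake parameter `q_v^{-s} α` of `Π` at `v` at some level `K(𝔫)`, `v ∤ 𝔫 ≠ 0`. Proof: `A_G` acts on
`W₀` by `a ↦ a^μ` (`exists_apply_posRealScalar_mul_eq_cpow`); with `s = -μ/(n[K:ℚ])` the twist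
`W₀ ⊗ |det|^s` (`exists_cuspidalAutomorphicRepData_map_mulChar_detTwist`) is `A_G`-invariant
(`mulChar_detTwist_apply_posRealScalar_mul_of_cpow`), hence associated with some `Π`
(`AutomorphicRepsGL.exists_isAssociatedL2_holds`: `W₀ ⊗ |det|^s = ⊥ ⊔ V_Π`); its Satake parameters
are `q_v^{-s} α` (`HasSatakeParamAt.of_map_mulChar_detTwist_of_cpow`) and are read in `L²` by the
named fact `hasSatakeParamAt_iff_L2`. [cite: BorelJacquetCorvallis1979, 5.7] -/
theorem CuspidalAutomorphicRepData.exists_twist_eq_formsOfL2_of_clean [NeZero n]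
    {μm : Measure (gl n K).automorphicQuotient} [(gl n K).IsAutomorphicMeasure μm]
    (hL2 : hasSatakeParamAt_iff_L2 hcpt μm)
    (π₀ : CuspidalAutomorphicRepData n K hcpt) (h0 : π₀.1.W' = ⊥) :
    ∃ (s : ℂ) (χ : HeckeCharacter K) (P : CuspidalAutomorphicRepGL n K μm),
      (∀ x : ideleGroup K, ((χ x : ℂˣ) : ℂ) = (GaloisRepresentations.ideleNorm x : ℂ) ^ s) ∧
      π₀.1.W.map (mulChar (detTwist n χ)) = formsOfL2 hcpt μm P.1 ∧
      ∀ (v : HeightOneSpectrum (𝓞 K)) (α : Multiset ℂ), π₀.1.HasSatakeParamAt v α →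
        ∃ (𝔫 : Ideal (𝓞 K)) (ϖ : (v.adicCompletion K)ˣ), 𝔫 ≠ 0 ∧ ¬ v.asIdeal ∣ 𝔫 ∧
          HasSatakeParameterAt P.1 (principalCongruenceLevel n K 𝔫) v ϖ
            (α.map (((v.residueCard : ℂ) ^ (-s)) * ·)) := by
  classical
  obtain ⟨μ, hμ⟩ := π₀.1.exists_apply_posRealScalar_mul_eq_cpow h0
  have hnd : ((n * Module.finrank ℚ K : ℕ) : ℂ) ≠ 0 := by
    exact_mod_cast (Nat.mul_ne_zero (NeZero.ne n) Module.finrank_pos.ne')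
  set s₀ : ℂ := -μ / (n * Module.finrank ℚ K : ℕ) with hs₀
  have hs : s₀ * (n * Module.finrank ℚ K : ℕ) = -μ := by rw [hs₀, div_mul_cancel₀ _ hnd]
  obtain ⟨χ, hχ⟩ := exists_heckeCharacter_ideleNorm_cpow K s₀
  -- the twisted datum `π₁ = π₀ ⊗ |det|^{s₀}`, `A_G`-invariant
  obtain ⟨π₁, h1W, h1W'⟩ := exists_cuspidalAutomorphicRepData_map_mulChar_detTwist hχ π₀
  have hAG : ∀ φ ∈ π₁.1.W, ∀ z ∈ (gl n K).center', ∀ g, φ (z * g) = φ g := by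
    intro φ hφ z hz g
    rw [h1W] at hφ
    obtain ⟨φ₀, hφ₀, rfl⟩ := hφ
    obtain ⟨t, rfl⟩ := hz
    exact mulChar_detTwist_apply_posRealScalar_mul_of_cpow hχ hs (hμ φ₀ hφ₀) t g
  -- pass to `L²`
  obtain ⟨P, hP⟩ := AutomorphicRepsGL.exists_isAssociatedL2_holds hcpt μm π₁ hAG
  have h1W'bot : π₁.1.W' = ⊥ := by rw [h1W', h0, Submodule.map_bot]
  refine ⟨s₀, χ, P, hχ, ?_, fun v α hα => ?_⟩
  · have hassoc : π₁.1.W = π₁.1.W' ⊔ formsOfL2 hcpt μm P.1 := hP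
    rw [← h1W, hassoc, h1W'bot, bot_sup_eq]
  · exact (hL2 hP v _).1
      (AutomorphicRepData.HasSatakeParamAt.of_map_mulChar_detTwist_of_cpow hχ h1W h1W' hα)

end Normalisation

/-! ### Nearly equivalent clean cuspidal data have the same space of forms -/

section Rigidity

/-- **Strong multiplicity one for clean cuspidal Borel–Jacquet data, `W`-level form.** Let
`π₀ = W₀ / ⊥` and `π₀' = W₀' / ⊥` be clean cuspidal data on `GL_n(𝔸_K)` (`n ≥ 1`) which are nearly
equivalent (the same Satake parameter at almost every finite place). Granting the named facts
`hasSatakeParamAt_iff_L2` (Borel–Jacquet 1979, 4.6, for the automorphic measure `μ`) and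
`strong_multiplicity_one_gl_sphericalLevel` (Jacquet–Shalika 1981, Thm. 4.4, with multiplicity
one), **`W₀ = W₀'`**. Proof. Normalise both (`exists_twist_eq_formsOfL2_of_clean`):
`W₀ ⊗ |det|^s = V_Π`, `W₀' ⊗ |det|^{s'} = V_{Π'}` with `t_{Π,v} = q_v^{-s} α_v`,
`t_{Π',v} = q_v^{-s'} α_v` at almost every `v` (`α_v` the common parameter). The central characters
`ω, ω'` of `Π, Π'` (`CuspidalAutomorphicRepGL.exists_centralCharacter`) are Hecke characters trivial
on `A_G` with `ω(ϖ_v) = e_n(t_{Π,v})`, so `(ω' ω⁻¹)(ϖ_v) = q_v^{n(s-s')} = ‖ϖ_v‖^{-n(s-s')}` for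
almost all `v`, whence `ω' ω⁻¹ = ‖·‖_𝔸^{-n(s-s')}`
(`HeckeCharacter.ext_of_eventually_valueAtUniformizer_eq`); on `A_G ∋ r` this reads
`1 = r^{-[K:ℚ] n (s-s')}` for every `r > 0`, so `s = s'`. Now `Π` and `Π'` have the same Satake
parameters at the local spherical levels `GL_n(𝒪_v)` off a finite set (level change
`HasSatakeParameterAt.sphericalLevelAt_of_principalCongruenceLevel`, uniqueness
`HasSatakeParameterAt.sphericalLevelAt_unique`, independence of the uniformizer
`HasSatakeParameterAt.of_valuation_eq`), hence `Π = Π'`, `V_Π = V_{Π'}`, and untwisting by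
`|det|^{-s}` (`mulChar_injective`) gives `W₀ = W₀'`. [cite: JacquetShalikaAJM1981II, Thm. 4.4]
[cite: BorelJacquetCorvallis1979, 5.7] -/
theorem CuspidalAutomorphicRepData.W_eq_of_isNearlyEquivalent_of_clean [NeZero n]
    {μm : Measure (gl n K).automorphicQuotient} [(gl n K).IsAutomorphicMeasure μm]
    (hL2 : hasSatakeParamAt_iff_L2 hcpt μm) (hsmo : strong_multiplicity_one_gl_sphericalLevel n K)
    (π₀ π₀' : CuspidalAutomorphicRepData n K hcpt) (h0 : π₀.1.W' = ⊥) (h0' : π₀'.1.W' = ⊥)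
    (hne : π₀.1.IsNearlyEquivalent π₀'.1) : π₀.1.W = π₀'.1.W := by
  classical
  obtain ⟨s, χ, P, hχ, hW, hSat⟩ := π₀.exists_twist_eq_formsOfL2_of_clean hL2 h0
  obtain ⟨s', χ', P', hχ', hW', hSat'⟩ := π₀'.exists_twist_eq_formsOfL2_of_clean hL2 h0'
  -- central characters of `Π`, `Π'`
  obtain ⟨ω, -, hωA, -, hωsat, -⟩ := P.exists_centralCharacter
  obtain ⟨ω', -, hω'A, -, hω'sat, -⟩ := P'.exists_centralCharacter
  have hq : ∀ v : HeightOneSpectrum (𝓞 K), (v.residueCard : ℂ) ≠ 0 := fun v => by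
    have := v.one_lt_residueCard
    exact_mod_cast (by omega : v.residueCard ≠ 0)
  have hqs : ∀ (v : HeightOneSpectrum (𝓞 K)) (t : ℂ), (v.residueCard : ℂ) ^ t ≠ 0 := fun v t h =>
    hq v ((Complex.cpow_eq_zero_iff _ _).1 h).1
  have hd : ((Module.finrank ℚ K : ℕ) : ℝ) ≠ 0 := by exact_mod_cast Module.finrank_pos.ne'
  -- the good places: a common Satake parameter of `π₀`, `π₀'`
  have hgood : ∀ᶠ v : HeightOneSpectrum (𝓞 K) in cofinite,
      ∃ α : Multiset ℂ, π₀.1.HasSatakeParamAt v α ∧ π₀'.1.HasSatakeParamAt v α := hne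
  -- Step 1: `s = s'` — the character `ω' ω⁻¹` is `‖·‖^{-n(s-s')}`
  obtain ⟨ν, hν⟩ := exists_heckeCharacter_ideleNorm_cpow K (-((n : ℂ) * (s - s')))
  have hval : ∀ᶠ v : HeightOneSpectrum (𝓞 K) in cofinite,
      (ω' * ω⁻¹).valueAtUniformizer v = ν.valueAtUniformizer v := by
    filter_upwards [hgood] with v hv
    obtain ⟨α, hα, hα'⟩ := hv
    obtain ⟨𝔫, ϖ, h𝔫, hv𝔫, hPv⟩ := hSat v α hα
    obtain ⟨𝔫', ϖ', h𝔫', hv𝔫', hP'v⟩ := hSat' v α hα'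
    have hcard : Multiset.card α = n := hα.card_eq
    have e1 : ω.valueAtUniformizer v = (v.residueCard : ℂ) ^ ((n : ℂ) * -s) * α.prod := by
      rw [(hωsat h𝔫 hv𝔫 hPv).2, Multiset.prod_map_mul, Multiset.map_const', Multiset.prod_replicate,
        Multiset.map_id', hcard, Complex.cpow_nat_mul]
    have e2 : ω'.valueAtUniformizer v = (v.residueCard : ℂ) ^ ((n : ℂ) * -s') * α.prod := by
      rw [(hω'sat h𝔫' hv𝔫' hP'v).2, Multiset.prod_map_mul, Multiset.map_const', Multiset.prod_replicate,
        Multiset.map_id', hcard, Complex.cpow_nat_mul]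
    have hne0 : ω.valueAtUniformizer v ≠ 0 := by
      simp only [GaloisRepresentations.HeckeCharacter.valueAtUniformizer]
      exact Units.ne_zero _
    have hαprod : α.prod ≠ 0 := by
      intro h0p
      rw [e1, h0p, mul_zero] at hne0
      exact hne0 rfl
    have hprod : (ω' * ω⁻¹).valueAtUniformizer v =
        ω'.valueAtUniformizer v * (ω.valueAtUniformizer v)⁻¹ := by
      simp only [GaloisRepresentations.HeckeCharacter.valueAtUniformizer,
        GaloisRepresentations.HeckeCharacter.localComponent_apply,
        GaloisRepresentations.HeckeCharacter.mul_apply, GaloisRepresentations.HeckeCharacter.inv_apply,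
        Units.val_mul, Units.val_inv_eq_inv_val]
    rw [hprod, e1, e2, valueAtUniformizer_of_cpow' hν v, Complex.cpow_neg, inv_inv, mul_inv,
      show ∀ X Y A B : ℂ, X * A * (Y * B) = X * Y * (A * B) from fun _ _ _ _ => by ring,
      mul_inv_cancel₀ hαprod, mul_one, ← Complex.cpow_neg, ← Complex.cpow_add _ _ (hq v)]
    congr 1
    ring
  have hην : ω' * ω⁻¹ = ν :=
    GaloisRepresentations.HeckeCharacter.ext_of_eventually_valueAtUniformizer_eq hval
  -- evaluate on `A_G`: `1 = r^{-[K:ℚ] n (s - s')}` for all `r > 0`, so `s = s'`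
  have hAval : ∀ r : ℝ≥0ˣ,
      ((((r : ℝ≥0) : ℝ) ^ Module.finrank ℚ K : ℝ) : ℂ) ^ (-((n : ℂ) * (s - s'))) = 1 := by
    intro r
    have e := congrArg (fun η : HeckeCharacter K => ((η (posRealIdele K r) : ℂˣ) : ℂ)) hην
    rw [GaloisRepresentations.HeckeCharacter.mul_apply, GaloisRepresentations.HeckeCharacter.inv_apply,
      hω'A r, hωA r, inv_one, mul_one, Units.val_one, hν, ← coe_ideleNorm,
      ideleNorm_posRealIdele_holds K r, NNReal.coe_pow] at e
    exact e.symm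
  have hexp : ∀ x : ℝ, Complex.exp ((x : ℂ) * (-((n : ℂ) * (s - s')))) = 1 := by
    intro x
    have hpos : 0 < Real.exp (x / Module.finrank ℚ K) := Real.exp_pos _
    let r : ℝ≥0ˣ := Units.mk0 ⟨Real.exp (x / Module.finrank ℚ K), hpos.le⟩
      (by rw [Ne, ← NNReal.coe_eq_zero]; exact hpos.ne')
    have e := hAval r
    have hrx : ((((r : ℝ≥0) : ℝ) ^ Module.finrank ℚ K : ℝ)) = Real.exp x := by
      change (Real.exp (x / Module.finrank ℚ K)) ^ Module.finrank ℚ K = Real.exp x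
      rw [← Real.exp_nat_mul]
      congr 1
      field_simp
    rw [hrx, Complex.ofReal_exp, Complex.cpow_def_of_ne_zero (Complex.exp_ne_zero _),
      Complex.log_exp (by rw [Complex.ofReal_im]; linarith [Real.pi_pos])
        (by rw [Complex.ofReal_im]; exact Real.pi_pos.le)] at e
    exact e
  have hw0 : (n : ℂ) * (s - s') = 0 :=
    neg_eq_zero.1 (eq_zero_of_forall_exp_ofReal_mul_eq_one hexp)
  have hss : s = s' := by
    have hn0 : (n : ℂ) ≠ 0 := Nat.cast_ne_zero.2 (NeZero.ne n)
    rcases mul_eq_zero.1 hw0 with h | h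
    · exact absurd h hn0
    · exact sub_eq_zero.1 h
  subst hss
  have hχχ' : χ = χ' :=
    GaloisRepresentations.HeckeCharacter.ext fun x => Units.ext (by rw [hχ x, hχ' x])
  subst hχχ'
  -- Step 2: `Π = Π'` by strong multiplicity one at the local spherical levels
  obtain ⟨S₀, hS₀⟩ : ∃ S₀ : Finset (HeightOneSpectrum (𝓞 K)), ∀ v ∉ S₀,
      ∃ α : Multiset ℂ, π₀.1.HasSatakeParamAt v α ∧ π₀'.1.HasSatakeParamAt v α := by
    refine ⟨(Filter.eventually_cofinite.mp hgood).toFinset, fun v hv => ?_⟩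
    by_contra h
    exact hv ((Filter.eventually_cofinite.mp hgood).mem_toFinset.mpr h)
  have hsph : ∀ v ∉ S₀, ∃ β : Multiset ℂ,
      (∃ ϖ : (v.adicCompletion K)ˣ, HasSatakeParameterAt P.1 (sphericalLevelAt K n v) v ϖ β) ∧
      (∃ ϖ : (v.adicCompletion K)ˣ, HasSatakeParameterAt P'.1 (sphericalLevelAt K n v) v ϖ β) := by
    intro v hv
    obtain ⟨α, hα, hα'⟩ := hS₀ v hv
    obtain ⟨𝔫, ϖ, h𝔫, hv𝔫, hPv⟩ := hSat v α hα
    obtain ⟨𝔫', ϖ', h𝔫', hv𝔫', hP'v⟩ := hSat' v α hα'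
    exact ⟨_, ⟨ϖ, hPv.sphericalLevelAt_of_principalCongruenceLevel h𝔫 hv𝔫⟩,
      ⟨ϖ', hP'v.sphericalLevelAt_of_principalCongruenceLevel h𝔫' hv𝔫'⟩⟩
  have hiff : ∀ v ∉ S₀, ∀ (ϖ : (v.adicCompletion K)ˣ) (β : Multiset ℂ),
      HasSatakeParameterAt P.1 (sphericalLevelAt K n v) v ϖ β ↔
        HasSatakeParameterAt P'.1 (sphericalLevelAt K n v) v ϖ β := by
    intro v hv ϖ β
    obtain ⟨β₀, ⟨ϖ₁, h₁⟩, ⟨ϖ₂, h₂⟩⟩ := hsph v hv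
    constructor
    · intro h
      have hβ : β = β₀ := HasSatakeParameterAt.sphericalLevelAt_unique P h h₁
      subst hβ
      exact h₂.of_valuation_eq (isMaximalAt_sphericalLevelAt n v) h.1
    · intro h
      have hβ : β = β₀ := HasSatakeParameterAt.sphericalLevelAt_unique P' h h₂
      subst hβ
      exact h₁.of_valuation_eq (isMaximalAt_sphericalLevelAt n v) h.1
  haveI : Infinite (HeightOneSpectrum (𝓞 K)) := infinite_heightOneSpectrum K
  obtain ⟨v₀, hv₀⟩ := Infinite.exists_notMem_finset S₀
  have hex : ∃ v ∉ S₀, ∃ (ϖ : (v.adicCompletion K)ˣ) (β : Multiset ℂ),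
      HasSatakeParameterAt P.1 (sphericalLevelAt K n v) v ϖ β := by
    obtain ⟨β₀, ⟨ϖ₁, h₁⟩, -⟩ := hsph v₀ hv₀
    exact ⟨v₀, hv₀, ϖ₁, β₀, h₁⟩
  have hPP' : P = P' := hsmo μm P P' S₀ hiff hex
  subst hPP'
  -- Step 3: untwist
  exact Submodule.map_injective_of_injective (mulChar_injective _) (hW.trans hW'.symm)

/-- **Strong multiplicity one for cuspidal Borel–Jacquet data, archimedean form** (Jacquet–Shalika
1981, Thm. 4.4: nearly equivalent cuspidal automorphic representations of `GL_n(𝔸_K)` are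
isomorphic, in particular at the archimedean places). For `n ≥ 1` and cuspidal data `π, π'` on
`GL_n(𝔸_K)` which are nearly equivalent, every archimedean parameter `χ` of `π` and `χ'` of `π'`
(`AutomorphicRepData.HasArchParameter`: the Harish-Chandra parameters, place by place, of the Lie
algebra action on `W / W'`) coincide, granted `hasSatakeParamAt_iff_L2` and
`strong_multiplicity_one_gl_sphericalLevel`. Proof: pass to clean models `π₀, π₀'` keeping the
Satake parameters and the archimedean parameters
(`exists_clean_hasSatakeParamAt_hasArchParameter_of_sSup_irreducible` with the proved semisimplicity
`stable_cuspidal_eq_sSup_irreducible_holds`); `π₀, π₀'` are again nearly equivalent (Flath: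
`hasSatakeParamAt_cofinite_holds`, `hasSatakeParamAt_unique_holds`), so `W₀ = W₀'`
(`W_eq_of_isNearlyEquivalent_of_clean`), i.e. `π₀ = π₀'`, and the archimedean parameter of one datum
is unique (`hasArchParameter_unique`, Harish-Chandra). [cite: JacquetShalikaAJM1981II, Thm. 4.4] -/
theorem CuspidalAutomorphicRepData.hasArchParameter_eq_of_isNearlyEquivalent [NeZero n]
    {μm : Measure (gl n K).automorphicQuotient} [(gl n K).IsAutomorphicMeasure μm]
    (hL2 : hasSatakeParamAt_iff_L2 hcpt μm) (hsmo : strong_multiplicity_one_gl_sphericalLevel n K)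
    (π π' : CuspidalAutomorphicRepData n K hcpt) (hne : π.1.IsNearlyEquivalent π'.1)
    {χ χ' : (K →+* ℂ) → Multiset ℂ} (hχ : π.1.HasArchParameter χ) (hχ' : π'.1.HasArchParameter χ') :
    χ = χ' := by
  obtain ⟨π₀, h0, h0sat, h0arch⟩ :=
    π.exists_clean_hasSatakeParamAt_hasArchParameter_of_sSup_irreducible
      AutomorphicRepsGL.stable_cuspidal_eq_sSup_irreducible_holds
  obtain ⟨π₀', h0', h0sat', h0arch'⟩ :=
    π'.exists_clean_hasSatakeParamAt_hasArchParameter_of_sSup_irreducible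
      AutomorphicRepsGL.stable_cuspidal_eq_sSup_irreducible_holds
  -- the clean models are nearly equivalent
  have hne0 : π₀.1.IsNearlyEquivalent π₀'.1 := by
    have hc := AutomorphicRepData.hasSatakeParamAt_cofinite_holds π₀.1
    have hc' := AutomorphicRepData.hasSatakeParamAt_cofinite_holds π₀'.1
    have hne' : ∀ᶠ v : HeightOneSpectrum (𝓞 K) in cofinite,
        ∃ α : Multiset ℂ, π.1.HasSatakeParamAt v α ∧ π'.1.HasSatakeParamAt v α := hne
    have hcc : ∀ᶠ v : HeightOneSpectrum (𝓞 K) in cofinite, π₀.1.IsUnramifiedAt v := hc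
    have hcc' : ∀ᶠ v : HeightOneSpectrum (𝓞 K) in cofinite, π₀'.1.IsUnramifiedAt v := hc'
    filter_upwards [hne', hcc, hcc'] with v hv hγ hγ'
    obtain ⟨α, hα, hα'⟩ := hv
    obtain ⟨γ, hγ⟩ := hγ
    obtain ⟨γ', hγ'⟩ := hγ'
    have e : γ = α := AutomorphicRepData.hasSatakeParamAt_unique_holds π.1 (h0sat v γ hγ) hα
    have e' : γ' = α := AutomorphicRepData.hasSatakeParamAt_unique_holds π'.1 (h0sat' v γ' hγ') hα'
    exact ⟨α, e ▸ hγ, e' ▸ hγ'⟩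
  have hW : π₀.1.W = π₀'.1.W :=
    CuspidalAutomorphicRepData.W_eq_of_isNearlyEquivalent_of_clean hL2 hsmo π₀ π₀' h0 h0' hne0
  have heq : π₀ = π₀' := Subtype.ext (repData_eq_of_W_eq hW (h0.trans h0'.symm))
  subst heq
  exact π₀.1.hasArchParameter_unique (h0arch χ hχ) (h0arch' χ' hχ')

/-- **Nearly equivalent cuspidal representations have infinity types with the same multisets of
`z`-exponents** (Jacquet–Shalika 1981, Thm. 4.4, on infinity types; all `n`): for cuspidal data
`π, π'` on `GL_n(𝔸_K)` which are nearly equivalent and infinity types `T` of `π`, `T'` of `π'`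
(`HasInfinityType`: well formed, carrying the archimedean parameter `ι ↦ {a of T at ι}`),
`{a of T at ι} = {a of T' at ι}` for every `ι : K →+* ℂ`, granted `hasSatakeParamAt_iff_L2` for all
automorphic measures on `GL_n(𝔸_K) ⧸ A_G GL_n(K)` and `strong_multiplicity_one_gl_sphericalLevel n K`.
For `n = 0` all multisets are empty; for `n ≥ 1` this is
`hasArchParameter_eq_of_isNearlyEquivalent`, the automorphic measure existing by
`AdelicGroupData.exists_isAutomorphicMeasure_gl_holds` (Borel–Harish-Chandra). This is the literal
hypothesis `hsmo` of `Patrikis2019_cmDescent_of_clozel_of_smo`. [cite: JacquetShalikaAJM1981II, Thm. 4.4] -/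
theorem CuspidalAutomorphicRepData.map_a_eq_of_isNearlyEquivalent
    (hL2 : ∀ (μ : Measure (gl n K).automorphicQuotient) [(gl n K).IsAutomorphicMeasure μ],
      hasSatakeParamAt_iff_L2 hcpt μ)
    (hsmo : strong_multiplicity_one_gl_sphericalLevel n K)
    (π π' : CuspidalAutomorphicRepData n K hcpt) (hne : π.1.IsNearlyEquivalent π'.1)
    {T T' : InfinityType K n} (hT : π.1.HasInfinityType T) (hT' : π'.1.HasInfinityType T')
    (ι : K →+* ℂ) : (T ι).map ArchWeight.a = (T' ι).map ArchWeight.a := by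
  rcases Nat.eq_zero_or_pos n with hn | hn
  · subst hn
    rw [Multiset.card_eq_zero.mp (hT.1.1 ι), Multiset.card_eq_zero.mp (hT'.1.1 ι)]
  · haveI : NeZero n := ⟨hn.ne'⟩
    obtain ⟨μm, hμm⟩ := AdelicGroupData.exists_isAutomorphicMeasure_gl_holds n K
    haveI := hμm
    exact congr_fun (CuspidalAutomorphicRepData.hasArchParameter_eq_of_isNearlyEquivalent (hL2 μm) hsmo
      π π' hne hT.2 hT'.2) ι

end Rigidity

end Literature.NumberTheory.Automorphic
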